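import Summits.Ventures.QEC.Census.CSSLPCertificate
import HarnessLib

/-!
# The CSS linear program with classical low-weight rows: «no CSS `[[n, k, D]]`» when a stabilizer span is forced to
# contain a light word

LADDER-QEC (venture cell `qec`), CENSUS-PREREG C.2 extension `13 ≤ n ≤ 16`, item 02.CSS151 (qec-type-02 g5, self-named).
Continuation of `Census/CSSLPCertificate.lean` (the CSS linear program `cssLPRows n a b D _` in the weight distributions
`α`, `β` of the two stabilizer spans `A = rs H^X` (`dim a`), `B = rs H^Z` (`dim b`), its Farkas checker and soundness).
qec-search-5 g3 (census/search-5/css-n16/OPEN-CELLS-g3.md) closed the cell `(15,1)` of the CSS distance table OUTSIDE the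
kernel by adding to that LP one classical fact: «every binary `[15, m]` code with `m ≥ 8` has a nonzero word of weight `≤ 4`»
— for a CSS code with `d^Z ≥ 5` such a word of `A⊥ = ker H^X` (`dim = 15 − a ≥ 8` when `a ≤ 7`) is NOT a `Z`-logical, hence
a `Z`-stabilizer: `B` has a nonzero word of weight `≤ 4`, i.e. `β_1 + β_2 + β_3 + β_4 ≥ 1` (dually for `A` when `b ≤ 7`).
The classical fact is now the tree theorem `Literature.InformationTheory.Coding.finrank_le_of_minDist_15_5` (qec-type-02,
`LinearSpherePackingBound.lean`). This file adds the two rows and their soundness, generically: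

* `rowAlphaLow D` / `rowBetaLow D` — the `≥`-rows `Σ_{1 ≤ j ≤ D−1} α_j ≥ 1` / `Σ_{1 ≤ j ≤ D−1} β_j ≥ 1`;
  `cssLPRowsLow n a b D lowA lowB := cssLPRows n a b D false ++ [rowAlphaLow D]? ++ [rowBetaLow D]?` (row order = the
  multiplier order of the certificates: the `4 + 2(n+1)` rows of `cssLPRows`, then the `α`-row if `lowA`, then the `β`-row
  if `lowB`);
* SOUNDNESS `lpFeasible_cssLPRowsLow_of_le`: for a CSS code with `rank H^X = a`, `rank H^Z = b`, `D ≤ d^X`, `D ≤ d^Z`, whose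
  `X`-span (if `lowA`) / `Z`-span (if `lowB`) contains a nonzero word of weight `< D`, the weight distributions are feasible;
* the INJECTION `CSSCode.exists_mem_rowSpZ_lt_of_linear_bound`: if every binary linear code of length `n` with all nonzero
  weights `≥ D` has dimension `≤ K` (a classical bound `B(n, D) ≤ 2^K`, hypothesis) and `K < n − rank H^X`, `D ≤ d^Z`, then
  `rs H^Z` contains a nonzero word of weight `< D` (`ker H^X` has dimension `n − rank H^X > K`, so it has a light nonzero
  word; being lighter than `d^Z` it is a `Z`-stabilizer, `CSSCode.mem_rowSpX_of_hammingNorm_lt_dX` for the swapped code);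
  `…rowSpX…` symmetrically;
* the census form **`css_min_dX_dZ_lt_of_farkasCheck_low`**: a classical bound `K` for `(n, D)`, flags `lowA ⇒ K < n − b`,
  `lowB ⇒ K < n − a`, and a checked Farkas certificate for `cssLPRowsLow n a b D lowA lowB` give `min (d^X, d^Z) < D` for
  every CSS code on `n` qubits with `rank H^X = a`, `rank H^Z = b`.
The cell file `Census/CSS/UpperLinearN15K1.lean` discharges `(15,1)` with it (15 certificates). HONEST FRAMING: still a
RELAXATION (infeasibility refutes, feasibility proves nothing); the only new information is the classical dimension bound,
entered as ONE linear inequality per side. [folklore] throughout (weak LP duality [cite: MacWilliamsSloane1977, Ch. 17 §4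
Thm. 20]; the injection is Calderbank–Shor–Steane bookkeeping).
-/

namespace Summit.Ventures.QEC.Census

open Finset Module Literature.InformationTheory.Coding Literature.InformationTheory.QuantumCodes

/-! ## The two low-weight rows and the extended system -/

/-- Row «`Σ_{1 ≤ r ≤ D−1} α_r ≥ 1`»: the `X`-span has a nonzero word of weight `< D`. [folklore] -/
def rowAlphaLow (D : ℕ) : LPRow := ⟨fun r => if 1 ≤ r ∧ r + 1 ≤ D then 1 else 0, fun _ => 0, 1, false⟩

/-- Row «`Σ_{1 ≤ r ≤ D−1} β_r ≥ 1`»: the `Z`-span has a nonzero word of weight `< D`. [folklore] -/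
def rowBetaLow (D : ℕ) : LPRow := ⟨fun _ => 0, fun r => if 1 ≤ r ∧ r + 1 ≤ D then 1 else 0, 1, false⟩

/-- **The CSS linear program with low-weight rows**: `cssLPRows n a b D false`, then `rowAlphaLow D` if `lowA`, then
`rowBetaLow D` if `lowB` (this is also the multiplier order of the certificates). Column: definition (ours). [folklore] -/
def cssLPRowsLow (n a b D : ℕ) (lowA lowB : Bool) : List LPRow :=
  cssLPRows n a b D false ++ ((if lowA then [rowAlphaLow D] else []) ++ (if lowB then [rowBetaLow D] else []))

/-! ## Soundness -/

section Soundness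

variable {n : ℕ} {RX RZ : Type*} [Fintype RX] [Fintype RZ]

/-- A word of `A` of weight `i` makes `A_i ≥ 1`. [folklore] -/
theorem one_le_wdist_of_mem {A : Submodule (ZMod 2) (Fin n → ZMod 2)} {v : Fin n → ZMod 2} (hv : v ∈ A) {i : ℕ}
    (hi : hammingNorm v = i) : 1 ≤ wdist A i := by
  classical
  unfold wdist
  exact Finset.card_pos.2 ⟨v, by simp [hv, hi]⟩

/-- Evaluating a low-weight row: the sum of the unknowns of index `1 ≤ r ≤ D − 1` (all of them `≤ n`). [folklore] -/
private theorem sum_ite_low_ge (n D : ℕ) (x : ℕ → ℚ) (hx : ∀ r, 0 ≤ x r) {j : ℕ} (hj1 : 1 ≤ j) (hjD : j + 1 ≤ D)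
    (hjn : j ≤ n) (hxj : 1 ≤ x j) :
    1 ≤ ∑ r ∈ range (n + 1), (if 1 ≤ r ∧ r + 1 ≤ D then (1 : ℚ) else 0) * x r := by
  have hle : (if 1 ≤ j ∧ j + 1 ≤ D then (1 : ℚ) else 0) * x j ≤
      ∑ r ∈ range (n + 1), (if 1 ≤ r ∧ r + 1 ≤ D then (1 : ℚ) else 0) * x r :=
    Finset.single_le_sum (f := fun r => (if 1 ≤ r ∧ r + 1 ≤ D then (1 : ℚ) else 0) * x r)
      (fun r _ => mul_nonneg (by split_ifs <;> norm_num) (hx r)) (by rw [mem_range]; omega)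
  rw [if_pos ⟨hj1, hjD⟩, one_mul] at hle
  exact hxj.trans hle

/-- The `α`-low row holds if `rs H^X` has a nonzero word of weight `< D`. [folklore] -/
theorem sat_rowAlphaLow (C : CSSCode RX RZ (Fin n)) {D : ℕ} (h : ∃ v ∈ C.rowSpX, v ≠ 0 ∧ hammingNorm v < D) :
    (rowAlphaLow D).Sat n (alphaOf C) (betaOf C) := by
  refine ⟨fun h' => absurd h' (by simp [rowAlphaLow]), fun _ => ?_⟩
  obtain ⟨v, hv, hv0, hvD⟩ := h
  simp only [rowAlphaLow, LPRow.eval, zero_mul, Finset.sum_const_zero, add_zero]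
  have hj1 : 1 ≤ hammingNorm v := Nat.one_le_iff_ne_zero.2 fun h0 => hv0 (hammingNorm_eq_zero.1 h0)
  have hjn : hammingNorm v ≤ n := le_trans hammingNorm_le_card_fintype (by rw [Fintype.card_fin])
  refine sum_ite_low_ge n D (alphaOf C) (fun r => Nat.cast_nonneg _) hj1 (by omega) hjn ?_
  unfold alphaOf
  exact_mod_cast one_le_wdist_of_mem hv rfl

/-- The `β`-low row holds if `rs H^Z` has a nonzero word of weight `< D`. [folklore] -/
theorem sat_rowBetaLow (C : CSSCode RX RZ (Fin n)) {D : ℕ} (h : ∃ v ∈ C.rowSpZ, v ≠ 0 ∧ hammingNorm v < D) :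
    (rowBetaLow D).Sat n (alphaOf C) (betaOf C) := by
  refine ⟨fun h' => absurd h' (by simp [rowBetaLow]), fun _ => ?_⟩
  obtain ⟨v, hv, hv0, hvD⟩ := h
  simp only [rowBetaLow, LPRow.eval, zero_mul, Finset.sum_const_zero, zero_add]
  have hj1 : 1 ≤ hammingNorm v := Nat.one_le_iff_ne_zero.2 fun h0 => hv0 (hammingNorm_eq_zero.1 h0)
  have hjn : hammingNorm v ≤ n := le_trans hammingNorm_le_card_fintype (by rw [Fintype.card_fin])
  refine sum_ite_low_ge n D (betaOf C) (fun r => Nat.cast_nonneg _) hj1 (by omega) hjn ?_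
  unfold betaOf
  exact_mod_cast one_le_wdist_of_mem hv rfl

/-- **Soundness of the extended system.** If `D ≤ d^X`, `D ≤ d^Z`, and the flagged spans contain a nonzero word of weight
`< D`, the weight distributions of `rs H^X`, `rs H^Z` are a feasible point of `cssLPRowsLow n (rank H^X) (rank H^Z) D lowA lowB`.
[folklore] -/
theorem lpFeasible_cssLPRowsLow_of_le (C : CSSCode RX RZ (Fin n)) {a b D : ℕ} (ha : C.HX.rank = a) (hb : C.HZ.rank = b)
    (hX : D ≤ C.dX) (hZ : D ≤ C.dZ) {lowA lowB : Bool}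
    (hA : lowA = true → ∃ v ∈ C.rowSpX, v ≠ 0 ∧ hammingNorm v < D)
    (hB : lowB = true → ∃ v ∈ C.rowSpZ, v ≠ 0 ∧ hammingNorm v < D) :
    LPFeasible (cssLPRowsLow n a b D lowA lowB) n (alphaOf C) (betaOf C) := by
  obtain ⟨hαnn, hβnn, hsat⟩ := lpFeasible_cssLPRows_of_le C ha hb hX hZ
  refine ⟨hαnn, hβnn, fun row hrow => ?_⟩
  rw [cssLPRowsLow, List.mem_append, List.mem_append] at hrow
  rcases hrow with hrow | hrow | hrow
  · exact hsat row hrow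
  · cases hl : lowA
    · rw [hl] at hrow; simp at hrow
    · rw [hl] at hrow
      rw [if_pos rfl, List.mem_singleton] at hrow
      rw [hrow]
      exact sat_rowAlphaLow C (hA hl)
  · cases hl : lowB
    · rw [hl] at hrow; simp at hrow
    · rw [hl] at hrow
      rw [if_pos rfl, List.mem_singleton] at hrow
      rw [hrow]
      exact sat_rowBetaLow C (hB hl)

/-! ## The injection: a classical dimension bound forces a light stabilizer -/

omit [Fintype RX] in
/-- **A classical bound `B(n, D) ≤ 2^K` forces a light `Z`-stabilizer.** If every binary linear code of length `n` whose
nonzero words have weight `≥ D` has dimension `≤ K`, and `K < n − rank H^X` (`= dim ker H^X = dim A⊥`), and `D ≤ d^Z`, then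
`rs H^Z` contains a nonzero word of weight `< D`: `ker H^X` is too big to have minimum weight `≥ D`, and its light words
are lighter than every `Z`-logical, hence `Z`-stabilizers. [folklore] -/
theorem CSSCode.exists_mem_rowSpZ_lt_of_linear_bound {K D : ℕ}
    (hlin : ∀ A : Submodule (ZMod 2) (Fin n → ZMod 2), (∀ x ∈ A, x ≠ 0 → D ≤ hammingNorm x) → finrank (ZMod 2) A ≤ K)
    (C : CSSCode RX RZ (Fin n)) (hK : K < n - C.HX.rank) (hZ : D ≤ C.dZ) :
    ∃ v ∈ C.rowSpZ, v ≠ 0 ∧ hammingNorm v < D := by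
  have hdim : finrank (ZMod 2) C.kerX = n - C.HX.rank := by
    have h := rank_add_finrank_pcCode C.HX
    rw [Fintype.card_fin] at h
    change C.HX.rank + finrank (ZMod 2) C.kerX = n at h
    omega
  have hnot : ¬ ∀ x ∈ C.kerX, x ≠ 0 → D ≤ hammingNorm x := fun h => by
    have := hlin C.kerX h
    omega
  push Not at hnot
  obtain ⟨x, hx, hx0, hxD⟩ := hnot
  refine ⟨x, ?_, hx0, hxD⟩
  have hmem : x ∈ C.swap.rowSpX :=
    C.swap.mem_rowSpX_of_hammingNorm_lt_dX ((C.mem_kerX_iff x).1 hx) (by rw [CSSCode.dX_swap]; omega)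
  exact hmem

omit [Fintype RZ] in
/-- **A classical bound forces a light `X`-stabilizer** (the same for `rs H^X`, `K < n − rank H^Z`, `D ≤ d^X`). [folklore] -/
theorem CSSCode.exists_mem_rowSpX_lt_of_linear_bound {K D : ℕ}
    (hlin : ∀ A : Submodule (ZMod 2) (Fin n → ZMod 2), (∀ x ∈ A, x ≠ 0 → D ≤ hammingNorm x) → finrank (ZMod 2) A ≤ K)
    (C : CSSCode RX RZ (Fin n)) (hK : K < n - C.HZ.rank) (hX : D ≤ C.dX) :
    ∃ v ∈ C.rowSpX, v ≠ 0 ∧ hammingNorm v < D := by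
  have hdim : finrank (ZMod 2) C.kerZ = n - C.HZ.rank := by
    have h := rank_add_finrank_pcCode C.HZ
    rw [Fintype.card_fin] at h
    change C.HZ.rank + finrank (ZMod 2) C.kerZ = n at h
    omega
  have hnot : ¬ ∀ x ∈ C.kerZ, x ≠ 0 → D ≤ hammingNorm x := fun h => by
    have := hlin C.kerZ h
    omega
  push Not at hnot
  obtain ⟨x, hx, hx0, hxD⟩ := hnot
  exact ⟨x, C.mem_rowSpX_of_hammingNorm_lt_dX ((C.mem_kerZ_iff x).1 hx) (by omega), hx0, hxD⟩

/-! ## The census form -/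

/-- **No CSS code of a certified cell beats `D − 1`, classical-bound form**: given a classical bound `B(n, D) ≤ 2^K`
(hypothesis `hlin`, e.g. `finrank_le_of_minDist_15_5` for `(n, D, K) = (15, 5, 7)`), flags with `lowA ⇒ K < n − b`,
`lowB ⇒ K < n − a`, and a checked Farkas certificate for `cssLPRowsLow n a b D lowA lowB`, every CSS code on `n` qubits
with `rank H^X = a`, `rank H^Z = b` has `min (d^X, d^Z) < D`. [folklore] -/
theorem css_min_dX_dZ_lt_of_farkasCheck_low {a b D K : ℕ} {lowA lowB : Bool} {ys : List ℚ}
    (hlin : ∀ A : Submodule (ZMod 2) (Fin n → ZMod 2), (∀ x ∈ A, x ≠ 0 → D ≤ hammingNorm x) → finrank (ZMod 2) A ≤ K)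
    (hKA : lowA = true → K < n - b) (hKB : lowB = true → K < n - a)
    (h : farkasCheck (cssLPRowsLow n a b D lowA lowB) ys n = true)
    (C : CSSCode RX RZ (Fin n)) (ha : C.HX.rank = a) (hb : C.HZ.rank = b) : min C.dX C.dZ < D := by
  by_contra hge
  rw [not_lt, le_min_iff] at hge
  refine not_lpFeasible_of_farkasCheck h (lpFeasible_cssLPRowsLow_of_le C ha hb hge.1 hge.2 ?_ ?_)
  · intro hl
    exact CSSCode.exists_mem_rowSpX_lt_of_linear_bound hlin C (by rw [hb]; exact hKA hl) hge.1
  · intro hl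
    exact CSSCode.exists_mem_rowSpZ_lt_of_linear_bound hlin C (by rw [ha]; exact hKB hl) hge.2

end Soundness

end Summit.Ventures.QEC.Census
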